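import Literature.MathematicalPhysics.QuantumFieldTheory.Balaban1983to89.B12Beta
import Literature.MathematicalPhysics.QuantumFieldTheory.Balaban1983to89.B12Sec2to5

/-!
# Gaps / D1ReadoutCrossWeight — the (1.22) OFF-DIAGONAL read-out of row (D1) is BLIND to the «cross» `{z : z_μ = 0 ∨ z_ν = 0}`
# (cell pub-balaban-gaps, seat g1-p1 GEN 4; kernel anchor of NOTE N-gapsg1p1-g4-2, journal l.49065; census row 33 of `HOME/g1/RESIDUE.md` part (D1))

HONEST FRAMING (cell rule, page 1 of everything): three lines of [folklore] arithmetic on the PRINTED read-out (1.22) of [Balaban1987RG1] p. 264,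
typed in the tree as `B12Beta.secondMoment P μ ν = ∑' z, P μ ν z · z_μ · z_ν`; nothing of Bałaban's asserted; (D1) NOT discharged; 0∕4 row-D1 binders;
NOT `BetaPertH`, NOT the continuum limit, NOT Clay.  HONEST DEPENDENCY (b2b cell, verbatim): «continuum YM on T⁴ ⇐ BetaPertH ∧ nine spine estimates
(0/9 proved); BetaPertH ⇐ (D1) ∧ (D4) ∧ CAP+tail; G-an2-4 gates asym, D1 and NE2/3/4.»

WHY (located).  Road «BF-x»'s one-loop words are resolvent Hessian kernels `ExpKernelCalculus.hessKer A V W μ ν z = ½·tadpole A (W μ 0 ν z) −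
½·bubble A (V μ 0) (V ν z)` (Beta/ExpKernelCalculus.lean :380) indexed by the COARSE bond displacement `z` between the two vertices, and every END of
the row reads them at `μ ≠ ν` (`D1Rep`, `Gaps.D1Residue.OneShotLaw`, the BF-x heads' `hμν`).  The owner's located finding F-g22-2
(`HOME/b2b-balaban-beta-d1-p2/FINDING-F-g22-2-CURRENCY.md` §3 (c)) counts, per word, a near-region size «n² for the same block, n across a face, log n
across a codim-2 edge».  The first two classes are `z = 0` and `z = ±e_ρ` — points of the cross — and contribute NOTHING to the off-diagonal (1.22)
moment, whatever the word: the weight `z_μ z_ν` vanishes there.  This file records that blindness as three citable lemmas (no estimate, no object of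
Bałaban's): `weight_eq_zero_of_cross`, **`secondMoment_eq_of_eqOn_offCross`** (two kernels agreeing off the cross have the same `(μ,ν)` second moment,
`μ ≠ ν` not even needed), **`secondMoment_eq_zero_of_support_l1_le_one`** (a kernel component supported in `{|z|₁ ≤ 1}` has zero `(μ,ν)` second
moment for `μ ≠ ν`).  So for the row's read-out the per-word near-region obstruction starts at the codim-2 class `{z_μ ≠ 0 ≠ z_ν}` (the owner's «log n»,
a per-word SLOPE SHARE — cf. leaf-04 R-1), not at «n²».  All [folklore]; 0 sorry; 0 def; imports `B12Beta` + `B12Sec2to5` (for `l1`) only.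
-/

namespace Summit.QuantumFields.BalabanUV.Gaps.D1ReadoutCrossWeight

open Literature.MathematicalPhysics.QuantumFieldTheory.Balaban1983to89
open Literature.MathematicalPhysics.QuantumFieldTheory.Balaban1983to89.B12Sec2to5 (l1)

variable {D : ℕ}

/-- [folklore] On the cross `{z_μ = 0} ∪ {z_ν = 0}` the (1.22) weight vanishes: `P μ ν z · z_μ · z_ν = 0`. -/
theorem weight_eq_zero_of_cross (P : B12Beta.Kernel D) {μ ν : Fin D} {z : Fin D → ℤ} (hz : z μ = 0 ∨ z ν = 0) :
    P μ ν z * (z μ : ℝ) * (z ν : ℝ) = 0 := by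
  rcases hz with h | h <;> simp [h]

/-- [folklore] **THE OFF-DIAGONAL READ-OUT IS BLIND TO THE CROSS**: if two kernels agree in the `(μ,ν)` component at every `z` with `z_μ ≠ 0` and
`z_ν ≠ 0`, their (1.22) second moments `Σ_z P_{μν}(z) z_μ z_ν` coincide (no summability and no `μ ≠ ν` needed: the weights of the remaining points
are zero on both sides). [cite: Balaban1987RG1, (1.22) p.264] -/
theorem secondMoment_eq_of_eqOn_offCross {P Q : B12Beta.Kernel D} {μ ν : Fin D}
    (h : ∀ z : Fin D → ℤ, z μ ≠ 0 → z ν ≠ 0 → P μ ν z = Q μ ν z) :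
    B12Beta.secondMoment P μ ν = B12Beta.secondMoment Q μ ν := by
  unfold B12Beta.secondMoment
  refine tsum_congr fun z => ?_
  by_cases hμ : z μ = 0
  · rw [weight_eq_zero_of_cross P (Or.inl hμ), weight_eq_zero_of_cross Q (Or.inl hμ)]
  by_cases hν : z ν = 0
  · rw [weight_eq_zero_of_cross P (Or.inr hν), weight_eq_zero_of_cross Q (Or.inr hν)]
  rw [h z hμ hν]

/-- [folklore] Off the diagonal, a point of `ℓ¹`-norm `≤ 1` lies on the cross: `|z|₁ ≤ 1`, `μ ≠ ν` ⟹ `z_μ = 0 ∨ z_ν = 0`. -/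
theorem cross_of_l1_le_one {μ ν : Fin D} (hμν : μ ≠ ν) {z : Fin D → ℤ} (hz : l1 z ≤ 1) : z μ = 0 ∨ z ν = 0 := by
  by_contra hcon
  obtain ⟨hμ, hν⟩ := not_or.mp hcon
  have h1 : (1 : ℝ) ≤ |(z μ : ℝ)| := by
    rw [← Int.cast_abs]; exact_mod_cast Int.one_le_abs hμ
  have h2 : (1 : ℝ) ≤ |(z ν : ℝ)| := by
    rw [← Int.cast_abs]; exact_mod_cast Int.one_le_abs hν
  have hsum : |(z μ : ℝ)| + |(z ν : ℝ)| ≤ l1 z := by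
    unfold B12Sec2to5.l1
    rw [← Finset.sum_pair (f := fun i => |(z i : ℝ)|) hμν]
    exact Finset.sum_le_sum_of_subset_of_nonneg (Finset.subset_univ _) fun i _ _ => abs_nonneg _
  linarith

/-- [folklore] **THE SAME-BLOCK AND FACE CLASSES DROP OUT**: for `μ ≠ ν`, a kernel whose `(μ,ν)` component is supported in `{z : |z|₁ ≤ 1}` (the
displacement classes «same block» `z = 0` and «across a face» `z = ±e_ρ` of the road's words) has ZERO (1.22) second moment.
[cite: Balaban1987RG1, (1.22) p.264] -/
theorem secondMoment_eq_zero_of_support_l1_le_one {P : B12Beta.Kernel D} {μ ν : Fin D} (hμν : μ ≠ ν)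
    (hsupp : ∀ z : Fin D → ℤ, 1 < l1 z → P μ ν z = 0) : B12Beta.secondMoment P μ ν = 0 := by
  have h0 : B12Beta.secondMoment (fun _ _ _ => (0 : ℝ)) μ ν = 0 := by
    unfold B12Beta.secondMoment; simp
  rw [← h0]
  refine secondMoment_eq_of_eqOn_offCross fun z hμ hν => ?_
  by_cases hz : l1 z ≤ 1
  · exact absurd (cross_of_l1_le_one hμν hz) (not_or.mpr ⟨hμ, hν⟩)
  · exact hsupp z (lt_of_not_ge hz)

/-- [folklore] **SPLITTING A WORD AT THE CROSS CHANGES NOTHING**: the (1.22) second moment of `P` equals that of its restriction OFF the cross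
(`z_μ ≠ 0 ∧ z_ν ≠ 0`), so any per-class bookkeeping of a word's off-diagonal moment may discard the classes `|z|₁ = 0` and `|z|₁ = 1` (and, more
generally, every `z` with `z_μ z_ν = 0`) before estimating. -/
theorem secondMoment_eq_restrict_offCross (P : B12Beta.Kernel D) (μ ν : Fin D) :
    B12Beta.secondMoment P μ ν =
      B12Beta.secondMoment (fun c e z => if z μ ≠ 0 ∧ z ν ≠ 0 then P c e z else 0) μ ν :=
  secondMoment_eq_of_eqOn_offCross fun z hμ hν => by simp [hμ, hν]

end Summit.QuantumFields.BalabanUV.Gaps.D1ReadoutCrossWeight
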